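import Literature.NumberTheory.EllipticCurves.ZpCorankQuasiIso
import HarnessLib

/-!
# Growth of `#A[p^k]` against the `ℤ_p`-corank: `p^{k·corank A} ≤ #A[p^k]`, hence a corank BOUND from a growth bound

Crux K4 `SignedControlAtTwo` (stmt-BirchSwinnertonDyer-20309; routes `ThetaPartnerAtTwo` / `ResidualThetaTransportAtTwo`),
line `eulerchar` v7 (stub `stub_pubGreenbergTwo` = PUB×4); width seat `prover-bsd-wall-tp2-p3-w3` g4. Part (G) of the
attempt on the third PUB antecedent `Greenberg1999.h1Sigma_zpCorank_le_degree ℚ` (Greenberg, LNM 1716, pp. 119–120: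
`corank_{ℤ_p} H¹(ℚ_Σ/ℚ, E[p^∞]) ≤ 1` when `Sel_{p^∞}(E/ℚ)` is finite).

Pure algebra for the tree's corank formula `zpCorank A p = dim_{𝔽_p} A[p] − dim_{𝔽_p} A/pA` (file `Selmer`;
meaningful for `p`-primary groups with finite `p`-torsion, Greenberg 1999 §1 «cofinitely generated»). The local counts
of the tree (Tate local duality, order form: `#H¹(K_v, E)[p^k] = #E(K_v)[p^k] · #(𝓞_v/p^k)`) bound the growth of
`#H[p^k]` for `H = H¹(K_Σ/K, E[p^∞])`; this file turns a growth bound into a corank bound: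

* `natCard_torsionBy_mul_le` — `#A[p] · #A[p^k] ≤ #A[p^{k+1}] · #(A/pA)` (the map `p : A[p^{k+1}] → A[p^k]` has
  kernel `A[p]` and its image contains the kernel `A[p^k] ∩ pA` of `A[p^k] → A/pA`);
* `pow_mul_zpCorank_le_natCard_torsionBy_pow` — `p^{k · zpCorank A p} ≤ #A[p^k]` for `A` `p`-primary with `A[p]`
  finite (induction, using the tree's `pow_zpCorank_mul_natCard_modN : p^{corank} · #(A/pA) = #A[p]`);
* `zpCorank_le_of_natCard_torsionBy_pow_le` — if `#A[p^k] ≤ C · p^{s·k}` for all `k` then `zpCorank A p ≤ s`.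

THEOREMS ONLY (no definition, no named fact, no `sorry`); nothing about any curve is asserted; BSD is not proved by
any of this.

References: [GreenbergLNM1716] R. Greenberg, *Iwasawa theory for elliptic curves*, LNM 1716 (1999), §1 (coranks of
cofinitely generated `ℤ_p`-modules), §4 pp. 119–120.
-/

set_option autoImplicit false
-- the Theorems namespace of this sub repeats the summit name by design (D-0017 nested layout)
set_option linter.dupNamespace false

noncomputable section

open scoped AddSubgroup

namespace Summit.BirchSwinnertonDyer.BirchSwinnertonDyer.Theorems.SignedEC.H1SigmaCorank

open Literature.NumberTheory.EllipticCurves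

variable {A : Type*} [AddCommGroup A] {p : ℕ}

/-- Membership in `A[p^k]` as `p ^ k • a = 0`. [folklore] -/
theorem mem_torsionBy_pow_iff (k : ℕ) (a : A) : a ∈ A[((p ^ k : ℕ) : ℤ)] ↔ p ^ k • a = 0 :=
  AddSubgroup.torsionBy.nsmul_iff

/-- **`#A[p] · #A[p^k] ≤ #A[p^{k+1}] · #(A/pA)`** for an abelian group with `A[p]` and `A/pA` finite.
Multiplication by `p` maps `A[p^{k+1}]` to `A[p^k]` with kernel `A[p]`, so `#A[p^{k+1}] = #A[p] · #(p A[p^{k+1}])`;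
and the kernel `A[p^k] ∩ pA` of `A[p^k] → A/pA` lies in `p A[p^{k+1}]` (if `x = p y` with `p^k x = 0` then
`p^{k+1} y = 0`), so `#A[p^k] ≤ #(p A[p^{k+1}]) · #(A/pA)`. [folklore] -/
theorem natCard_torsionBy_mul_le [Finite A[(p : ℤ)]] [Finite (ModN A p)] (k : ℕ) :
    Nat.card A[(p : ℤ)] * Nat.card A[((p ^ k : ℕ) : ℤ)] ≤
      Nat.card A[((p ^ (k + 1) : ℕ) : ℤ)] * Nat.card (ModN A p) := by
  haveI : Finite A[((p ^ k : ℕ) : ℤ)] := finite_torsionBy_pow A p k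
  haveI : Finite A[((p ^ (k + 1) : ℕ) : ℤ)] := finite_torsionBy_pow A p (k + 1)
  -- multiplication by `p` : `A[p^{k+1}] → A[p^k]`
  let ψ : A[((p ^ (k + 1) : ℕ) : ℤ)] →+ A[((p ^ k : ℕ) : ℤ)] :=
    ((nsmulAddMonoidHom p).comp (A[((p ^ (k + 1) : ℕ) : ℤ)]).subtype).codRestrict _ fun x ↦
      AddSubgroup.torsionBy.nsmul_iff.mpr (by
        change p ^ k • p • (x : A) = 0
        rw [smul_smul, ← pow_succ, ← AddSubgroupClass.coe_nsmul, AddSubgroup.torsionBy.nsmul x,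
          ZeroMemClass.coe_zero])
  have hψ : ∀ x, ((ψ x : A[((p ^ k : ℕ) : ℤ)]) : A) = p • (x : A) := fun _ ↦ rfl
  -- its kernel is `A[p]`
  have hker : Nat.card ψ.ker = Nat.card A[(p : ℤ)] := by
    refine Nat.card_congr (Equiv.ofBijective
      (fun x : ψ.ker ↦ (⟨((x : A[((p ^ (k + 1) : ℕ) : ℤ)]) : A), AddSubgroup.torsionBy.nsmul_iff.mpr ?_⟩ :
        A[(p : ℤ)])) ⟨?_, ?_⟩)
    · have hx := x.2
      rw [AddMonoidHom.mem_ker] at hx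
      have := congrArg (fun z : A[((p ^ k : ℕ) : ℤ)] ↦ (z : A)) hx
      simpa only [hψ, ZeroMemClass.coe_zero] using this
    · intro x y hxy
      exact Subtype.ext (Subtype.ext (congrArg (fun z : A[(p : ℤ)] ↦ (z : A)) hxy))
    · intro z
      have hz : p • (z : A) = 0 := AddSubgroup.torsionBy.nsmul_iff.mp z.2
      have hz' : (z : A) ∈ A[((p ^ (k + 1) : ℕ) : ℤ)] := AddSubgroup.torsionBy.nsmul_iff.mpr (by
        rw [pow_succ, mul_smul, hz, smul_zero])
      refine ⟨⟨⟨(z : A), hz'⟩, ?_⟩, Subtype.ext rfl⟩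
      rw [AddMonoidHom.mem_ker]
      exact Subtype.ext (by rw [hψ]; exact hz)
  -- `#A[p^{k+1}] = #A[p] · #(range ψ)`
  have hsplit : Nat.card A[((p ^ (k + 1) : ℕ) : ℤ)] = Nat.card A[(p : ℤ)] * Nat.card ψ.range := by
    rw [← hker]; exact natCard_eq_card_ker_mul_card_range ψ
  -- `A[p^k] → A/pA`, kernel inside `range ψ`
  let π : A[((p ^ k : ℕ) : ℤ)] →+ ModN A p := (ModN.mkQ p).comp (A[((p ^ k : ℕ) : ℤ)]).subtype
  have hπker : Nat.card π.ker ≤ Nat.card ψ.range := by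
    refine Nat.card_le_card_of_injective (fun x : π.ker ↦ (⟨(x : A[((p ^ k : ℕ) : ℤ)]), ?_⟩ : ψ.range)) ?_
    · have hx := x.2
      rw [AddMonoidHom.mem_ker] at hx
      change ModN.mkQ p ((x : A[((p ^ k : ℕ) : ℤ)]) : A) = 0 at hx
      obtain ⟨y, hy⟩ := (mkQ_eq_zero_iff p _).mp hx
      have hy' : y ∈ A[((p ^ (k + 1) : ℕ) : ℤ)] := AddSubgroup.torsionBy.nsmul_iff.mpr (by
        rw [pow_succ, mul_smul, ← natCast_zsmul y p, hy]
        exact AddSubgroup.torsionBy.nsmul_iff.mp (x : A[((p ^ k : ℕ) : ℤ)]).2)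
      refine ⟨⟨y, hy'⟩, Subtype.ext ?_⟩
      rw [hψ]
      change p • y = _
      rw [← natCast_zsmul y p, hy]
    · intro x y hxy
      exact Subtype.ext (congrArg (fun z : ψ.range ↦ (z : A[((p ^ k : ℕ) : ℤ)])) hxy)
  have hπrange : Nat.card π.range ≤ Nat.card (ModN A p) :=
    Nat.card_le_card_of_injective _ π.range.subtype_injective
  have hk : Nat.card A[((p ^ k : ℕ) : ℤ)] ≤ Nat.card ψ.range * Nat.card (ModN A p) := by
    rw [natCard_eq_card_ker_mul_card_range π]
    exact Nat.mul_le_mul hπker hπrange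
  calc Nat.card A[(p : ℤ)] * Nat.card A[((p ^ k : ℕ) : ℤ)]
      ≤ Nat.card A[(p : ℤ)] * (Nat.card ψ.range * Nat.card (ModN A p)) := Nat.mul_le_mul_left _ hk
    _ = Nat.card A[((p ^ (k + 1) : ℕ) : ℤ)] * Nat.card (ModN A p) := by rw [hsplit]; ring

/-- **`p^{k · zpCorank A p} ≤ #A[p^k]`** for a `p`-primary abelian group `A` with finite `p`-torsion: the corank
is a lower growth rate of the `p^k`-torsion (for `A ≅ (ℚ_p/ℤ_p)^r ⊕ (finite)` one has `#A[p^k] ≍ p^{rk}`).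
Induction on `k` with `natCard_torsionBy_mul_le` and `p^{corank} · #(A/pA) = #A[p]` (tree
`pow_zpCorank_mul_natCard_modN`). [cite: GreenbergLNM1716, §1 (coranks of cofinitely generated modules)] -/
theorem pow_mul_zpCorank_le_natCard_torsionBy_pow [hp : Fact p.Prime] (hA : ∀ a : A, ∃ n : ℕ, p ^ n • a = 0)
    [Finite A[(p : ℤ)]] (k : ℕ) : p ^ (k * zpCorank A p) ≤ Nat.card A[((p ^ k : ℕ) : ℤ)] := by
  obtain ⟨hfin, _⟩ := finite_modN_of_primary hA
  haveI := hfin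
  induction k with
  | zero =>
    haveI : Finite A[((p ^ 0 : ℕ) : ℤ)] := finite_torsionBy_pow A p 0
    calc p ^ (0 * zpCorank A p) = 1 := by rw [zero_mul, pow_zero]
      _ ≤ Nat.card A[((p ^ 0 : ℕ) : ℤ)] := Nat.one_le_iff_ne_zero.mpr Nat.card_pos.ne'
  | succ k ih =>
    haveI : Finite A[((p ^ k : ℕ) : ℤ)] := finite_torsionBy_pow A p k
    haveI : Finite A[((p ^ (k + 1) : ℕ) : ℤ)] := finite_torsionBy_pow A p (k + 1)
    have hmod : 0 < Nat.card (ModN A p) := Nat.card_pos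
    have hkey := natCard_torsionBy_mul_le (A := A) (p := p) k
    rw [← pow_zpCorank_mul_natCard_modN hA] at hkey
    -- hkey : p^r · #(A/pA) · #A[p^k] ≤ #A[p^{k+1}] · #(A/pA)
    have h2 : p ^ zpCorank A p * Nat.card A[((p ^ k : ℕ) : ℤ)] ≤ Nat.card A[((p ^ (k + 1) : ℕ) : ℤ)] := by
      refine Nat.le_of_mul_le_mul_right ?_ hmod
      calc p ^ zpCorank A p * Nat.card A[((p ^ k : ℕ) : ℤ)] * Nat.card (ModN A p)
          = p ^ zpCorank A p * Nat.card (ModN A p) * Nat.card A[((p ^ k : ℕ) : ℤ)] := by ring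
        _ ≤ Nat.card A[((p ^ (k + 1) : ℕ) : ℤ)] * Nat.card (ModN A p) := hkey
    calc p ^ ((k + 1) * zpCorank A p) = p ^ zpCorank A p * p ^ (k * zpCorank A p) := by ring
      _ ≤ p ^ zpCorank A p * Nat.card A[((p ^ k : ℕ) : ℤ)] := Nat.mul_le_mul_left _ ih
      _ ≤ Nat.card A[((p ^ (k + 1) : ℕ) : ℤ)] := h2

/-- **A growth bound gives a corank bound**: if `A` is `p`-primary with `A[p]` finite and `#A[p^k] ≤ C · p^{s·k}`
for every `k`, then `zpCorank A p ≤ s`. (With `r = zpCorank A p`: `p^{rk} ≤ C · p^{sk}` for all `k`; if `r > s`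
then `p^k ≤ C` for all `k`, absurd.) [cite: GreenbergLNM1716, §1 (coranks of cofinitely generated modules)] -/
theorem zpCorank_le_of_natCard_torsionBy_pow_le [hp : Fact p.Prime] (hA : ∀ a : A, ∃ n : ℕ, p ^ n • a = 0)
    [Finite A[(p : ℤ)]] {C s : ℕ} (hC : ∀ k : ℕ, Nat.card A[((p ^ k : ℕ) : ℤ)] ≤ C * p ^ (s * k)) :
    zpCorank A p ≤ s := by
  by_contra h
  rw [not_le] at h
  -- `p ^ k ≤ C` for every `k`
  have hle : ∀ k : ℕ, p ^ k ≤ C := fun k ↦ by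
    have h1 := (pow_mul_zpCorank_le_natCard_torsionBy_pow hA k).trans (hC k)
    -- `p^{k r} = p^{k s} · p^{k (r - s)}` and `p^{k(r-s)} ≥ p^k`
    have hr : k * zpCorank A p = s * k + k * (zpCorank A p - s) := by
      have := h.le
      zify [this]
      ring
    rw [hr, pow_add, mul_comm (C : ℕ)] at h1
    have hpos : 0 < p ^ (s * k) := pow_pos hp.out.pos _
    have h2 : p ^ (k * (zpCorank A p - s)) ≤ C := Nat.le_of_mul_le_mul_left h1 hpos
    refine le_trans ?_ h2
    exact Nat.pow_le_pow_right hp.out.pos (Nat.le_mul_of_pos_right k (Nat.sub_pos_of_lt h))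
  have := hle C
  exact absurd this (not_le.mpr (Nat.lt_pow_self hp.out.one_lt))

/-- A `p`-primary group whose `p^k`-torsion has BOUNDED order is finite (it equals `A[p^N]` as soon as
`#A[p^{N+1}] = #A[p^N]`, and such an `N ≤ B` exists). Spelled without choosing `N`: if `#A[p^k] ≤ B` for all `k`
and `A[p]` is finite, then `A` is finite. [folklore] -/
theorem finite_of_natCard_torsionBy_pow_le (hA : ∀ a : A, ∃ n : ℕ, p ^ n • a = 0)
    [Finite A[(p : ℤ)]] {B : ℕ} (hB : ∀ k : ℕ, Nat.card A[((p ^ k : ℕ) : ℤ)] ≤ B) : Finite A := by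
  -- the chain `A[p^k]` is increasing with bounded finite cardinalities, hence stationary from some `N`
  have hfin : ∀ k, Finite A[((p ^ k : ℕ) : ℤ)] := fun k ↦ finite_torsionBy_pow A p k
  have hmono : ∀ k, A[((p ^ k : ℕ) : ℤ)] ≤ A[((p ^ (k + 1) : ℕ) : ℤ)] := fun k a ha ↦
    AddSubgroup.torsionBy.nsmul_iff.mpr (by
      rw [pow_succ', mul_smul, AddSubgroup.torsionBy.nsmul_iff.mp ha, smul_zero])
  -- cardinalities form a bounded monotone sequence of naturals: find `N` with equality `#A[p^N] = #A[p^{N+j}]` for all j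
  have hcard_mono : Monotone fun k ↦ Nat.card A[((p ^ k : ℕ) : ℤ)] := by
    refine monotone_nat_of_le_succ fun k ↦ ?_
    haveI := hfin (k + 1)
    exact Nat.card_le_card_of_injective _ (AddSubgroup.inclusion_injective (hmono k))
  -- a bounded monotone ℕ-sequence is eventually constant
  obtain ⟨N, hN⟩ : ∃ N, ∀ k, N ≤ k → Nat.card A[((p ^ k : ℕ) : ℤ)] = Nat.card A[((p ^ N : ℕ) : ℤ)] := by
    by_contra hcon
    -- then the sequence increases strictly infinitely often: exceeds `B`
    have hstep : ∀ N, ∃ k, N ≤ k ∧ Nat.card A[((p ^ N : ℕ) : ℤ)] + 1 ≤ Nat.card A[((p ^ k : ℕ) : ℤ)] := by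
      intro N
      by_contra hN
      refine hcon ⟨N, fun k hk ↦ ?_⟩
      by_contra hne
      exact hN ⟨k, hk, Nat.succ_le_of_lt (lt_of_le_of_ne (hcard_mono hk) (Ne.symm hne))⟩
    have hgrow : ∀ j : ℕ, ∃ k, j ≤ Nat.card A[((p ^ k : ℕ) : ℤ)] := by
      intro j
      induction j with
      | zero => exact ⟨0, Nat.zero_le _⟩
      | succ j ih =>
        obtain ⟨k, hk⟩ := ih
        obtain ⟨k', -, hk'⟩ := hstep k
        exact ⟨k', (Nat.succ_le_succ hk).trans hk'⟩
    obtain ⟨k, hk⟩ := hgrow (B + 1)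
    exact absurd ((hk.trans (hB k))) (by omega)
  -- `A = A[p^N]`
  haveI := hfin N
  refine Finite.of_surjective (fun x : A[((p ^ N : ℕ) : ℤ)] ↦ (x : A)) fun a ↦ ?_
  obtain ⟨n, hn⟩ := hA a
  -- `a ∈ A[p^n] ≤ A[p^{max n N}] = A[p^N]` by cardinality
  have hle' : ∀ {i j : ℕ}, i ≤ j → A[((p ^ i : ℕ) : ℤ)] ≤ A[((p ^ j : ℕ) : ℤ)] := fun {i j} hij ↦ by
    induction hij with
    | refl => exact le_rfl
    | step _ ih => exact ih.trans (hmono _)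
  have hmem : a ∈ A[((p ^ (max n N) : ℕ) : ℤ)] := hle' (le_max_left n N) (AddSubgroup.torsionBy.nsmul_iff.mpr hn)
  have heq : A[((p ^ N : ℕ) : ℤ)] = A[((p ^ (max n N) : ℕ) : ℤ)] := by
    haveI := hfin (max n N)
    exact AddSubgroup.eq_of_le_of_card_ge (hle' (le_max_right n N)) (hN _ (le_max_right n N)).le
  exact ⟨⟨a, heq ▸ hmem⟩, rfl⟩

end Summit.BirchSwinnertonDyer.BirchSwinnertonDyer.Theorems.SignedEC.H1SigmaCorank

end
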